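import Literature.IUT.HodgeTheaters.CoveringsErrata
import Literature.AnabelianGeometry.SemiGraphs.PSCUnrVerticialOneVertex
import HarnessLib

/-!
# [IUTchI] Remark 1.2.3 (vii), necessity (`Rmk123.UnrVerticialNecessityReduction`): the typed row is a
# SCHEMA over the origin parameter — instance forms, and the universal closure refuted (PROOF-ONLY)

S. Mochizuki, *Inter-universal Teichmüller theory I*, kurims manuscript (May 2020), Remark 1.2.3 (vii),
p. 43 — the replacement text of the final paragraph of the proof of [CombGC] Theorem 1.6 (iii): "On the
other hand, necessity follows formally from the characterization of unramified verticial subgroups given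
in Remark 1.4.3 and the characterization of verticially purely totally ramified finite étale coverings
given in Remark 1.4.2" ([IUTchI] Rmk 1.2.3 (vii) p.43) [claim: Mochizuki2012, status: disputed].  Typed by
abc-iut-L5-t6 as `Rmk123.UnrVerticialNecessityReduction Ω` (`CoveringsErrata.lean`), a statement
`∀ G H β l, …` over the BLACKBOX origin parameter `Ω : PSCOrigin` ([CombGC] Def. 1.1 (i) "of pro-Σ
PSC-type", never constructed in the tree); abc-iut FACT-LIST row **F-1980** (plan/F-TRANCHES.tsv
tranche 187).

PROOF-ONLY companion (no `def`, no `structure`, no `instance`; abc-iut-f-187, F-TRANCHES programme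
D-0078).  What the kernel says about the ROW AS TYPED:

* `unrVerticialNecessityReduction_of_unrVerticialIffHolds` — at EVERY origin the row is the necessity
  half of [CombGC] Thm. 1.6 (iii) as typed (`PSCDatum.UnrVerticialIffHolds Ω`, row F-0461): the six
  displayed characterization hypotheses and `Σ = {l}` are not needed for that implication (CONDITIONAL
  form, F-1980 ⇐ F-0461);
* `unrVerticialNecessityReduction_of_vertGp_eq_top` — INSTANCE FORM: the row HOLDS at every origin all of
  whose data have one vertex class with `Π_v = Π` (any edges) — the shape Def. 1.1 extracts from a SMOOTH
  curve — by abc-iut-f-009's `unrVerticiallyFiltrationPreservingIffVerticial_of_smoothProper`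
  (`PSCSmoothProperShape.lean`); `exists_smoothProperOrigin_unrVerticialNecessityReduction` — such an
  origin is INHABITED by the genuine STURDY datum of a smooth proper genus-2 curve in characteristic 0
  (`PSCUnrVerticialOneVertex.exists_smoothProperOrigin_holds`, carrier `Ŝ₂`), so the instance is not
  vacuous in the sturdiness hypothesis;
* `not_unrVerticialNecessityReduction_all` / `not_forall_unrVerticialNecessityReduction` — the UNIVERSAL
  CLOSURE `∀ Ω, UnrVerticialNecessityReduction Ω` is FALSE: at the all-inclusive origin
  (`IsOfPSCType := True`) take junk data over the TRIVIAL group — `G` with EMPTY semi-graph, `H` with one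
  vertex (genus 2, no edges), `Σ = {2}`, `β = id`.  Every displayed hypothesis holds (all subgroup
  identities by `Subgroup Π` being a one-element lattice; the count hypotheses are vacuous since no
  subgroup has index `2^k`, `k > 0`; `G`'s characterizations are vacuous for want of vertices), but the
  conclusion's clause "every unramified verticial subgroup of `Π^unr_H` arises from one of `Π^unr_G`"
  fails: `H` has one, `G` has none;
* `unrVerticialNecessityReduction_schema` — hence the row is a SCHEMA (holds at one origin, fails at
  another): consumable only ORIGIN-RELATIVELY, as the cell does (`CoveringsErrataNecessityProofs.lean`:
  `unrVerticialNecessityReduction_of_originStatements` derives it at every profinite origin from named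
  origin-level statements).

Refuting a universal closure over junk data asserts nothing about pointed stable curves or about the
printed sentence; FACT policy: F-1980 is an assumption label; no side is taken on [IUTchIII] Cor. 3.12.
-/

noncomputable section

namespace Literature.IUT.HodgeTheaters.Rmk123

open Literature.AnabelianGeometry.SemiGraphs
open Literature.GroupTheory.CombinatorialGroupTheory (PuncturedSurfaceGroup)
open scoped Pointwise

universe u

/-! ### F-1980 ⇐ F-0461 at every origin -/

/-- **[IUTchI] Rmk. 1.2.3 (vii), necessity, from [CombGC] Thm. 1.6 (iii) as typed**: at every origin
`Ω`, `UnrVerticialNecessityReduction Ω` is the necessity half of `PSCDatum.UnrVerticialIffHolds Ω`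
(sturdy `G`, `H`; the characterization hypotheses and `Σ = {l}` displayed in the row are idle for this
implication). [cite: Mochizuki2012, IUTchI Rmk 1.2.3 (vii) p.43] -/
theorem unrVerticialNecessityReduction_of_unrVerticialIffHolds (Ω : PSCOrigin.{u})
    (h : PSCDatum.UnrVerticialIffHolds Ω) : UnrVerticialNecessityReduction Ω := by
  intro Q _ _ _ Q' _ _ _ G H β l hG hH hGs hHs _ _ _ _ _ _ _ _ hβ
  exact (h G H β hG hH hGs hHs).mp hβ

/-! ### Instance form: one vertex class with `Π_v = Π` -/

/-- **F-1980 HOLDS at every origin of one-vertex data with `Π_v = Π`** (any edges; the shape of the datum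
of a smooth curve): there every `β : Π^unr_G ≅ Π^unr_H` is group-theoretically verticial outright (the
unramified verticial subgroups on both sides are exactly the whole group), by abc-iut-f-009's
`unrVerticiallyFiltrationPreservingIffVerticial_of_smoothProper`.
[cite: Mochizuki2012, IUTchI Rmk 1.2.3 (vii) p.43] -/
theorem unrVerticialNecessityReduction_of_vertGp_eq_top (Ω : PSCOrigin.{u})
    (hΩ : ∀ ⦃Q : Type u⦄ [Group Q] [TopologicalSpace Q] (G : PSCDatum Q), Ω.IsOfPSCType G →
      (∀ v, G.vertGp v = ⊤) ∧ Nonempty G.graph.V) :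
    UnrVerticialNecessityReduction Ω := by
  refine unrVerticialNecessityReduction_of_unrVerticialIffHolds Ω ?_
  intro Q _ _ _ Q' _ _ _ G H β hG hH
  obtain ⟨hV, ⟨v₀⟩⟩ := hΩ G hG
  obtain ⟨hW, ⟨w₀⟩⟩ := hΩ H hH
  exact G.unrVerticiallyFiltrationPreservingIffVerticial_of_smoothProper H hV v₀ hW w₀ β

/-- **The one-vertex origin is inhabited by genuine STURDY data and satisfies F-1980**: the origin
`Ω_sp` of all smooth-proper-shaped data (one vertex, no edges, `Π_v = Π`;
`PSCUnrVerticialOneVertex.exists_smoothProperOrigin_holds`) contains the sturdy datum of a smooth proper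
genus-2 curve in characteristic 0 (carrier `Ŝ₂` = profinite completion of the surface group `Γ_{2,0}`,
`Σ` = all primes, genus 2) and satisfies [CombGC] Thm. 1.6 (iii) as typed (F-0461), hence
`UnrVerticialNecessityReduction` — non-vacuously in the sturdiness hypotheses.  Consistency evidence for
the typed row, not the printed sentence for all pointed stable curves.
[cite: Mochizuki2012, IUTchI Rmk 1.2.3 (vii) p.43] -/
theorem exists_smoothProperOrigin_unrVerticialNecessityReduction :
    ∃ Ω : PSCOrigin.{0},
      (∃ G : PSCDatum (profiniteCompletion (PuncturedSurfaceGroup 2 0)),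
        Ω.IsOfPSCType G ∧ G.IsSturdy ∧ G.Sigma = {p : ℕ | p.Prime} ∧ G.graph.i = 1 ∧ G.graph.n = 0 ∧
          G.graph.r = 0 ∧ ∀ v, G.vertGp v = ⊤ ∧ G.genus v = 2) ∧
      PSCDatum.UnrVerticialIffHolds Ω ∧ UnrVerticialNecessityReduction Ω := by
  obtain ⟨Ω, hG, -, -, -, -, -, -, h461, -⟩ := PSCDatum.exists_smoothProperOrigin_holds
  exact ⟨Ω, hG, h461, unrVerticialNecessityReduction_of_unrVerticialIffHolds Ω h461⟩

/-! ### The universal closure is false -/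

/-- **F-1980 FAILS at the all-inclusive origin** (`IsOfPSCType := True`): junk data over the trivial
group — `G` with empty semi-graph, `H` with one vertex of genus 2 (no edges), `Σ = {2}`, `β = id` —
satisfy every displayed hypothesis of the row (one-element subgroup lattice; the count hypotheses are
vacuous: no subgroup has index `2 ^ k` with `k > 0`), while the unramified verticial subgroup `Π^unr_H`
of `H` does not arise from `G`, which has no vertex. [cite: Mochizuki2012, IUTchI Rmk 1.2.3 (vii) p.43] -/
theorem not_unrVerticialNecessityReduction_all :
    ¬ UnrVerticialNecessityReduction (⟨fun _ => True⟩ : PSCOrigin.{0}) := by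
  intro h
  -- pro-`{2}`: the trivial group has no nontrivial finite quotient
  have hpro : IsProSigma {2} PUnit.{1} :=
    ⟨fun U _ p hp hdvd => by
      have h1 : Nat.card (PUnit.{1} ⧸ U.toSubgroup) ∣ 1 := by
        have := Subgroup.card_quotient_dvd_card U.toSubgroup
        rwa [Nat.card_unique (α := PUnit.{1})] at this
      exact absurd (Nat.dvd_one.mp (hdvd.trans h1)) hp.ne_one⟩
  -- `G`: EMPTY semi-graph over the trivial group
  let G : PSCDatum PUnit.{1} :=
    { Sigma := {2}, sigma_prime := by simp [Nat.prime_two], sigma_nonempty := ⟨2, rfl⟩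
      graph := { V := Empty, N := Empty, C := Empty, nodeEnds := Empty.elim, cuspEnd := Empty.elim }
      vertGp := Empty.elim, nodeGp := Empty.elim, cuspGp := Empty.elim, genus := Empty.elim
      isClosed_vertGp := fun v => v.elim
      isClosed_nodeGp := fun e => e.elim, isClosed_cuspGp := fun c => c.elim
      nodeGp_le := fun e => e.elim, cuspGp_le := fun c => c.elim
      proSigma := hpro }
  -- `H`: ONE vertex (genus 2, `Π_v = Π`), no edges, over the trivial group
  let H : PSCDatum PUnit.{1} :=
    { Sigma := {2}, sigma_prime := by simp [Nat.prime_two], sigma_nonempty := ⟨2, rfl⟩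
      graph := { V := Unit, N := Empty, C := Empty, nodeEnds := Empty.elim, cuspEnd := Empty.elim }
      vertGp := fun _ => ⊤, nodeGp := Empty.elim, cuspGp := Empty.elim, genus := fun _ => 2
      isClosed_vertGp := fun _ => isClosed_discrete _
      isClosed_nodeGp := fun e => e.elim, isClosed_cuspGp := fun c => c.elim
      nodeGp_le := fun e => e.elim, cuspGp_le := fun c => c.elim
      proSigma := hpro }
  -- `β = id` (the two kernels are the same subgroup, definitionally)
  let β : (PUnit.{1} ⧸ G.unrKer) ≃ₜ* (PUnit.{1} ⧸ H.unrKer) := ContinuousMulEquiv.refl _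
  -- in the trivial group no subgroup has index `l ^ k`, `Σ = {l}`, `k > 0`
  have hidx : ∀ (l k : ℕ) (H' : Subgroup PUnit.{1}), ({2} : Set ℕ) = {l} → 0 < k →
      H'.index ≠ l ^ k := by
    intro l k H' hl hk
    rw [Subsingleton.elim H' ⊤, Subgroup.index_top, ← Set.singleton_eq_singleton_iff.mp hl]
    exact (Nat.one_lt_two_pow_iff.mpr hk.ne').ne
  have hGs : G.IsSturdy := fun v => v.elim
  have hHs : H.IsSturdy := fun _ => le_rfl
  have hG1 : G.UnrVerticialSplitInjection := fun _ =>
    ⟨fun v => v.elim, ⊤, isClosed_discrete _, le_top, Subsingleton.elim _ _, Subsingleton.elim _ _⟩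
  have hG2 : G.ElementaryQuotientVerticiallyRamifiedIff := fun _ _ _ _ _ _ _ _ =>
    ⟨fun ⟨_, v, _⟩ => v.elim, fun ⟨v, _⟩ => v.elim⟩
  have hH1 : H.UnrVerticialSplitInjection := fun _ =>
    ⟨fun _ => Subsingleton.elim _ _, ⊤, isClosed_discrete _, le_top, Subsingleton.elim _ _,
      Subsingleton.elim _ _⟩
  have hH2 : H.ElementaryQuotientVerticiallyRamifiedIff := fun _ _ H' _ _ hO _ _ =>
    iff_of_true
      ⟨⟨le_top, hO, isOpen_discrete _, inferInstance⟩, (), 1, Subsingleton.elim _ _,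
        fun _ _ _ => (Subsingleton.elim _ _).le⟩
      ⟨(), Subsingleton.elim _ _, fun v' hv' => absurd (Subsingleton.elim _ _) hv'⟩
  have hG3 : G.VerticialPureRamificationCount := fun l k H' hl hk _ _ hi _ =>
    absurd hi (hidx l k H' hl hk)
  have hH3 : H.VerticialPureRamificationCount := fun l k H' hl hk _ _ hi _ =>
    absurd hi (hidx l k H' hl hk)
  have hβ : G.IsUnrVerticiallyFiltrationPreserving H β := fun _ _ _ => Subsingleton.elim _ _
  obtain ⟨-, hsurj⟩ := h G H β 2 trivial trivial hGs hHs rfl rfl hG1 hG2 hH1 hH2 hG3 hH3 hβ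
  obtain ⟨B, ⟨A, ⟨v, -, -⟩, -⟩, -⟩ :=
    hsurj ⊤ ⟨⊤, ⟨(), 1, Subsingleton.elim _ _⟩, Subsingleton.elim _ _⟩
  exact v.elim

/-- **The universal closure of FACT row F-1980 is REFUTED**: `Rmk123.UnrVerticialNecessityReduction`
does not hold at every origin. [cite: Mochizuki2012, IUTchI Rmk 1.2.3 (vii) p.43] -/
theorem not_forall_unrVerticialNecessityReduction :
    ¬ ∀ Ω : PSCOrigin.{0}, UnrVerticialNecessityReduction Ω := fun h =>
  not_unrVerticialNecessityReduction_all (h _)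

/-- **F-1980 is a SCHEMA over the origin parameter**: it holds at one origin (the inhabited smooth-curve
smooth-proper origin) and fails at another (the all-inclusive one) — an origin-relative assumption label, never a
closed fact. [cite: Mochizuki2012, IUTchI Rmk 1.2.3 (vii) p.43] -/
theorem unrVerticialNecessityReduction_schema :
    (∃ Ω : PSCOrigin.{0}, UnrVerticialNecessityReduction Ω) ∧
      ∃ Ω : PSCOrigin.{0}, ¬ UnrVerticialNecessityReduction Ω := by
  obtain ⟨Ω, -, -, hΩ⟩ := exists_smoothProperOrigin_unrVerticialNecessityReduction
  exact ⟨⟨Ω, hΩ⟩, _, not_unrVerticialNecessityReduction_all⟩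

end Literature.IUT.HodgeTheaters.Rmk123

end
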